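import Literature.NumberTheory.EllipticCurves.Zywina2025RankTwo
import HarnessLib

set_option linter.dupNamespace false -- namespace `…BirchSwinnertonDyer.BirchSwinnertonDyer…` is the cell's (D-0017 nested layout)
set_option autoImplicit false

/-!
# Twin″ (item 19140) on the additive PRIME-TWIST family, I: the `2`-isogeny Selmer sets of
# `E_{−ℓ} : y² = x³ − 21ℓ x² + 112ℓ² x` (`= 49a1^{(−ℓ)}` up to `ℚ`-isomorphism), `ℓ ≡ 1 (mod 4)` prime
# inert in `ℚ(√−7)`

Cell `bsd-goldfeld`, seat `bsd-goldfeld-s1p-c301` (gen 2); `--supports stmt-BirchSwinnertonDyer-19140`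
(`Summit.BirchSwinnertonDyer.BirchSwinnertonDyer.Theses.GoldfeldAllTwistsTwoConverse.BSDTwoCMSevenAdditiveRankOne`,
twin″ = Miller's `BSD(W,2)` on the additive-at-`2` CM-`7` cell in analytic rank one = `BSD(·,2)` for the
minimal models of the analytic-rank-one twists `49a1^{(d)}`, `d ≢ 1 (mod 4)`, by the landed
`bsdTwoCMSevenAdditiveRankOne_of_twists`). PARTITION: types-the-object-of the open P2 cell
`r1.addv.borel.split` on the infinite sub-family `d = −ℓ`. Sibling file
`GoldfeldAllTwistsTwoConverseTwinAdditivePrimeTwistDescent.lean` turns the two containments proved here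
into `rank ≤ 1`, `Ш[2] = 0` in rank one, and the reduction of `BSD(W,2)` to a `2`-adic unit statement.
HONEST FRAMING: nothing here proves `BSD(W,2)` for any curve; BSD is not proved by any of this.

For a squarefree `d`, `49a1^{(d)} = cm7.quadraticTwist d` is `ℚ`-isomorphic to the two-torsion normal form
`E_d : y² = x³ + 21d x² + 112d² x` (sibling file, `twoTorsionModel_eq_smul_quadraticTwist`), so the tree's
explicit Selmer sets of the `2`-isogeny with kernel `{O, (0,0)}` apply (`TwoIsogenySelmerGroup*.lean`,
Silverman X.4.9): `S(a,b)` = descent on the divisors of `b = 112d²`, `S'(a,b) = S(−2a, a² − 4b) =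
S(−42d, −7d²)`. With `d = −ℓ`, `ℓ` prime, `ℓ ≡ 1 (mod 4)`, `(−7/ℓ) = −1`:

* `not_isSoluble_padic_of_prime_dvd_coeffs` — a LOCAL LEMMA at any prime `p` dividing all three
  coefficients of `d u⁴ + a u²z² + d' z⁴` (`a = pc`, `d = pe`, `d' = pe'`): if `c² − 4ee'` is a non-square
  mod `p` there is no `ℚ_p`-point (in a `ℤ_p`-chart `s² = p(e + ct² + e't⁴)`, so `p ∣ e + ct² + e't⁴`, and
  mod `p` the quadratic `e'T² + cT + e` would have a root).
* `mem_of_mem_twoIsogenySelmerGroup_primeTwist`: **`S(−21ℓ, 112ℓ²) ⊆ {1, 2, 7, 14}`** — negative classes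
  die at `ℝ` (`a = −21ℓ < 0`); classes divisible by `ℓ` die at `ℓ` (reduced discriminant
  `21² − 4·112 = −7`, a non-residue); the rest are the positive squarefree divisors of `112ℓ²` prime to
  `ℓ`, i.e. of `14`.
* `mem_of_mem_twoIsogenySelmerGroup'_primeTwist`: **`S(42ℓ, −7ℓ²) ⊆ {1, −7}`** — classes divisible by `ℓ`
  die at `ℓ` (`42² + 28 = 1792 = 7·16²` and `(7/ℓ) = (−1/ℓ)(−7/ℓ) = −1`); `−1` and `7` die at `7`
  (`7 ∥ (42ℓ)² + 28ℓ² = 1792ℓ²`, and `−1`, `−ℓ²` are non-residues mod `7`: Zywina's local lemma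
  `isSquare_zmod_of_isSoluble_padic`).

Numerically (this seat, local sample; and gen 0's kit tables j248486/j248731 for `|d| ≤ 3000`) both
containments are equalities: `S = {1,2,7,14}`, `S' = {1,−7}` for `ℓ ∈ {5, 13, 17, 41, 73, 89, 97}`; the
equalities are not needed below. NOT treated: the sibling families `d = −2ℓ` (two `2`-adic local lemmas
needed) and split `ℓ` (there `S = {1, 7, 2ℓ, 14ℓ}` for `ℓ ≡ 5 (mod 8)`).

## References

* J. H. Silverman, *The Arithmetic of Elliptic Curves*, 2nd ed. (2009), Prop. X.4.9, Example X.4.10.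
  [SilvermanAEC2009]
* D. Zywina, *There are infinitely many elliptic curves over the rationals of rank 2*, arXiv:2502.01957,
  Lemma 3.1 (the `ℤ_p`-chart and odd-prime local lemmas reused from `Zywina2025RankTwo.lean`). [Zywina2025]
* B. H. Gross, *Arithmetic on Elliptic Curves with Complex Multiplication*, LNM 776 (1980), §§22–24
  (first descents on the twists of `A(7) = X₀(49)`). [Gross1980LNM776]

## Design

Theorems only (no `def`, no named fact, no `instance`/`notation`); `ℓ` is a natural prime carried as
`[Fact ℓ.Prime]` because `legendreSym` needs it; "`ℓ` inert in `ℚ(√−7)`" is the hypothesis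
`legendreSym ℓ (−7) = −1`.
-/

noncomputable section

open scoped Classical

open WeierstrassCurve Literature.NumberTheory.EllipticCurves
open Literature.NumberTheory.EllipticCurves.Zywina2025 (exists_padicInt_of_isSoluble
  isSquare_zmod_of_isSoluble_padic)

namespace Summit.BirchSwinnertonDyer.BirchSwinnertonDyer.Theorems.GoldfeldGoodTwists

/-! ## §1. A local lemma: a prime dividing all three coefficients of `d u⁴ + a u²z² + d' z⁴` -/

/-- In `ℤ_p`: `x mod p = 0 ↔ p ∣ x`. [folklore] -/
private theorem toZMod_eq_zero_iff_dvd {p : ℕ} [Fact p.Prime] (x : ℤ_[p]) :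
    PadicInt.toZMod x = 0 ↔ (p : ℤ_[p]) ∣ x := by
  rw [← RingHom.mem_ker, PadicInt.ker_toZMod, PadicInt.maximalIdeal_eq_span_p,
    Ideal.mem_span_singleton]

/-- Core of the local lemma: `s² = p · (f + c t² + f' t⁴)` has no solution `t, s ∈ ℤ_p` when
`c² − 4 f f'` is a non-square modulo `p` (`p ∣ s`, so `p ∣ f + c t² + f' t⁴`; modulo `p` the quadratic
`f' T² + c T + f` (`T = t²`) would have the root `T`, forcing its discriminant to be the square
`(2 f' T + c)²`). [folklore] -/
private theorem not_sq_eq_prime_mul_quartic {p : ℕ} [Fact p.Prime] {f c f' m : ℤ} (hm : f * f' = m)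
    (hns : ¬ IsSquare (((c ^ 2 - 4 * m : ℤ)) : ZMod p)) {t s : ℤ_[p]}
    (h : s ^ 2 = (p : ℤ_[p]) * ((f : ℤ_[p]) + (c : ℤ_[p]) * t ^ 2 + (f' : ℤ_[p]) * t ^ 4)) :
    False := by
  have hpp : Prime (p : ℤ_[p]) := PadicInt.prime_p
  have hps : (p : ℤ_[p]) ∣ s := hpp.dvd_of_dvd_pow (n := 2) ⟨_, h⟩
  obtain ⟨s₁, rfl⟩ := hps
  have hg : (p : ℤ_[p]) ∣ ((f : ℤ_[p]) + (c : ℤ_[p]) * t ^ 2 + (f' : ℤ_[p]) * t ^ 4) := by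
    refine ⟨s₁ ^ 2, mul_left_cancel₀ hpp.ne_zero ?_⟩
    rw [← h]
    ring
  have hg0 : PadicInt.toZMod ((f : ℤ_[p]) + (c : ℤ_[p]) * t ^ 2 + (f' : ℤ_[p]) * t ^ 4) = 0 :=
    (toZMod_eq_zero_iff_dvd _).mpr hg
  simp only [map_add, map_mul, map_pow, map_intCast] at hg0
  have hm' : ((m : ℤ) : ZMod p) = (f : ZMod p) * f' := by rw [← hm]; push_cast; ring
  apply hns
  refine ⟨2 * (f' : ZMod p) * PadicInt.toZMod t ^ 2 + c, ?_⟩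
  push_cast
  rw [hm']
  linear_combination (-4 * (f' : ZMod p)) * hg0

/-- **Local lemma (any prime `p`).** If `p` divides all three coefficients — `a = p c`, `d = p e`,
`d' = p e'` — and the reduced discriminant `c² − 4 e e'` is a NON-square modulo `p`, then
`w² = d u⁴ + a u²z² + d' z⁴` has no non-trivial `ℚ_p`-point: in either `ℤ_p`-chart
(`exists_padicInt_of_isSoluble`) the equation reads `s² = p (e + c t² + e' t⁴)` (or with `e, e'`
exchanged), impossible by `not_sq_eq_prime_mul_quartic`. Used at `p = ℓ` for the classes divisible by
`ℓ`. [cite: SilvermanAEC2009, Prop. X.4.9 and Example X.4.10] -/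
theorem not_isSoluble_padic_of_prime_dvd_coeffs {p : ℕ} [Fact p.Prime] {a d d' c e e' m : ℤ}
    (ha : a = p * c) (hd : d = p * e) (hd' : d' = p * e') (hm : e * e' = m)
    (hns : ¬ IsSquare (((c ^ 2 - 4 * m : ℤ)) : ZMod p)) :
    ¬ ((twoIsogenyQuartic a d d').map (Int.castRingHom ℚ_[p])).IsSoluble := by
  intro h
  obtain ⟨f, f', hff, t, s, hs⟩ := exists_padicInt_of_isSoluble h
  rcases hff with ⟨rfl, rfl⟩ | ⟨rfl, rfl⟩
  · exact not_sq_eq_prime_mul_quartic hm hns (t := t) (s := s)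
      (by rw [hs, ha, hd, hd']; push_cast; ring)
  · exact not_sq_eq_prime_mul_quartic (by rw [mul_comm]; exact hm) hns (t := t) (s := s)
      (by rw [hs, ha, hd, hd']; push_cast; ring)

/-! ## §2. The number-theoretic inputs at `ℓ` and at `7` -/

/-- `(−7/ℓ) = −1` and `ℓ ≡ 1 (mod 4)` give `(7/ℓ) = −1` (`−7 = (−1)·7`, `(−1/ℓ) = χ₄(ℓ) = 1`). [folklore] -/
private theorem legendreSym_seven_eq_neg_one {l : ℕ} [Fact l.Prime] (hl4 : l % 4 = 1)
    (hl7 : legendreSym l (-7) = -1) : legendreSym l 7 = -1 := by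
  have hl2 : l ≠ 2 := by rintro rfl; norm_num at hl4
  have h1 : legendreSym l (-1) = 1 := by
    rw [legendreSym.at_neg_one hl2, ZMod.χ₄_nat_one_mod_four hl4]
  have hmul : legendreSym l (-7) = legendreSym l (-1) * legendreSym l 7 := by
    rw [← legendreSym.mul]; norm_num
  rwa [hmul, h1, one_mul] at hl7

/-- `ℓ ≠ 7` when `(−7/ℓ) = −1` (for `ℓ = 7` the symbol is `0`). [folklore] -/
private theorem ne_seven_of_legendreSym {l : ℕ} [Fact l.Prime] (hl7 : legendreSym l (-7) = -1) :
    l ≠ 7 := by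
  rintro rfl
  have h0 : legendreSym 7 (-7) = 0 :=
    (legendreSym.eq_zero_iff 7 (-7)).mpr ((ZMod.intCast_zmod_eq_zero_iff_dvd (-7) 7).mpr ⟨-1, by norm_num⟩)
  rw [h0] at hl7
  norm_num at hl7

/-- `1792 = 7 · 16²` is a non-square modulo an odd prime `ℓ` with `(7/ℓ) = −1`. [folklore] -/
private theorem not_isSquare_seventeenNinetyTwo {l : ℕ} [Fact l.Prime] (hl2 : l ≠ 2)
    (h7 : legendreSym l 7 = -1) : ¬ IsSquare (((1792 : ℤ)) : ZMod l) := by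
  have h7' : ¬ IsSquare ((7 : ℤ) : ZMod l) := (legendreSym.eq_neg_one_iff l).mp h7
  rintro ⟨r, hr⟩
  apply h7'
  have h16 : (16 : ZMod l) ≠ 0 := by
    intro h
    have h2 : ((2 ^ 4 : ℕ) : ZMod l) = 0 := by exact_mod_cast h
    rw [ZMod.natCast_eq_zero_iff] at h2  -- l ∣ 2^4
    exact hl2 ((Nat.prime_dvd_prime_iff_eq (Fact.out) Nat.prime_two).mp
      ((Fact.out : l.Prime).dvd_of_dvd_pow h2))
  refine ⟨r * (16 : ZMod l)⁻¹, ?_⟩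
  have hr' : r * r = 7 * 16 ^ 2 := by
    rw [← hr]; push_cast; norm_num
  push_cast
  calc (7 : ZMod l) = 7 * (16 * (16 : ZMod l)⁻¹) ^ 2 := by rw [mul_inv_cancel₀ h16]; ring
    _ = r * r * ((16 : ZMod l)⁻¹) ^ 2 := by rw [hr']; ring
    _ = r * (16 : ZMod l)⁻¹ * (r * (16 : ZMod l)⁻¹) := by ring

/-- `−1` is a non-square modulo `7` (`χ₄(7) = −1`). [folklore] -/
private theorem not_isSquare_neg_one_zmod_seven : ¬ IsSquare (((-1 : ℤ)) : ZMod 7) := by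
  haveI : Fact (Nat.Prime 7) := ⟨by norm_num⟩
  exact (legendreSym.eq_neg_one_iff 7).mp
    (by rw [legendreSym.at_neg_one (by norm_num), ZMod.χ₄_nat_three_mod_four (by norm_num)])

/-- `7 ∥ 1792 ℓ²` for a prime `ℓ ≠ 7`: `7² ∤ 1792 ℓ²` (`1792 = 7 · 256`). [folklore] -/
private theorem not_sq_seven_dvd {l : ℕ} (hl : l.Prime) (hl7 : l ≠ 7) :
    ¬ ((7 : ℤ) ^ 2 ∣ 1792 * (l : ℤ) ^ 2) := by
  intro h
  have h7p : Prime (7 : ℤ) := Int.prime_iff_natAbs_prime.mpr (by norm_num)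
  have h1 : (7 : ℤ) ∣ 256 * (l : ℤ) ^ 2 := by
    have h' : (7 : ℤ) * 7 ∣ 7 * (256 * (l : ℤ) ^ 2) := by
      rw [← pow_two, show (7 : ℤ) * (256 * (l : ℤ) ^ 2) = 1792 * (l : ℤ) ^ 2 by ring]; exact h
    exact (mul_dvd_mul_iff_left (by norm_num : (7 : ℤ) ≠ 0)).mp h'
  rcases h7p.dvd_or_dvd h1 with h2 | h2
  · norm_num at h2
  · have h3 : (7 : ℤ) ∣ (l : ℤ) := h7p.dvd_of_dvd_pow h2
    have h4 : (7 : ℕ) ∣ l := by exact_mod_cast h3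
    exact hl7 ((Nat.prime_dvd_prime_iff_eq (by norm_num) hl).mp h4).symm

/-! ## §3. The Selmer sets of `E_{−ℓ} : y² = x³ − 21ℓ x² + 112ℓ² x` -/

/-- **`S(−21ℓ, 112ℓ²) ⊆ {1, 2, 7, 14}`** for a prime `ℓ` with `(−7/ℓ) = −1`: the descent-on-divisors-of-`b`
Selmer set of `E_{−ℓ}` (Silverman X.4.9: squarefree `d ∣ 112ℓ²` with `w² = d u⁴ − 21ℓ u²z² + (112ℓ²/d) z⁴`
everywhere locally soluble). Negative `d`: no real point (`a = −21ℓ ≤ 0`, both outer coefficients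
negative). `ℓ ∣ d`: then `ℓ ∥ d`, `ℓ ∥ 112ℓ²/d` and the reduced discriminant is `21² − 4·112 = −7`, a
non-residue mod `ℓ` — no `ℚ_ℓ`-point (`not_isSoluble_padic_of_prime_dvd_coeffs`). What is left are the
positive squarefree divisors of `112ℓ²` prime to `ℓ`, i.e. the positive divisors of `14`.
[cite: SilvermanAEC2009, Prop. X.4.9 and Example X.4.10] -/
theorem mem_of_mem_twoIsogenySelmerGroup_primeTwist {l : ℕ} [Fact l.Prime]
    (hl7 : legendreSym l (-7) = -1) {d : ℤ}
    (hd : d ∈ twoIsogenySelmerGroup (-21 * l) (112 * l ^ 2)) :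
    d ∈ ({1, 2, 7, 14} : Finset ℤ) := by
  have hl : l.Prime := Fact.out
  have hlp : Prime (l : ℤ) := Nat.prime_iff_prime_int.mp hl
  have hl0 : (l : ℤ) ≠ 0 := by exact_mod_cast hl.ne_zero
  have hb : (112 * l ^ 2 : ℤ) ≠ 0 := by positivity
  rw [mem_twoIsogenySelmerGroup_iff hb] at hd
  obtain ⟨hsqf, ⟨d', hdd'⟩, hloc⟩ := hd
  have hd'eq : (112 * l ^ 2 : ℤ) / d = d' := by
    rw [hdd', Int.mul_ediv_cancel_left _ hsqf.ne_zero]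
  rw [hd'eq] at hloc
  obtain ⟨hreal, hpadic⟩ := hloc
  -- the real place: `d > 0`
  have hdpos : 0 < d := by
    rcases lt_or_gt_of_ne hsqf.ne_zero with hneg | hpos
    · exfalso
      have hbpos : (0 : ℤ) < 112 * (l : ℤ) ^ 2 := by positivity
      have hd'neg : d' < 0 := by
        by_contra hcon
        nlinarith [mul_nonpos_iff.mpr (Or.inr ⟨hneg.le, le_of_not_gt hcon⟩)]
      have ha : (-21 * (l : ℤ)) ≤ 0 := by
        have : (0 : ℤ) ≤ l := by positivity
        linarith
      exact not_isSoluble_real_twoIsogenyQuartic_of_neg hneg hd'neg ha hreal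
    · exact hpos
  -- the place `ℓ`: `ℓ ∤ d`
  have hld : ¬ (l : ℤ) ∣ d := by
    rintro ⟨e, rfl⟩
    have h1 : e * d' = 112 * l := mul_left_cancel₀ hl0 (by linear_combination (-1 : ℤ) * hdd')
    have h2 : (l : ℤ) ∣ e * d' := ⟨112, by rw [h1]; ring⟩
    rcases hlp.dvd_or_dvd h2 with h3 | h3
    · -- `ℓ² ∣ d`: not squarefree
      obtain ⟨e₁, rfl⟩ := h3
      exact hlp.not_unit (hsqf (l : ℤ) ⟨e₁, by ring⟩)
    · obtain ⟨e', rfl⟩ := h3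
      have hm : e * e' = 112 := mul_left_cancel₀ hl0 (by linear_combination h1)
      have hns : ¬ IsSquare ((((-21) ^ 2 - 4 * 112 : ℤ)) : ZMod l) := by
        rw [show ((-21 : ℤ) ^ 2 - 4 * 112 : ℤ) = -7 by norm_num]
        exact (legendreSym.eq_neg_one_iff l).mp hl7
      exact not_isSoluble_padic_of_prime_dvd_coeffs (p := l) (c := -21) (by ring) rfl rfl hm hns
        (hpadic l)
  -- so `d ∣ 14`
  have h14 : d ∣ 14 := by
    have h0 : d ∣ 112 * (l : ℤ) ^ 2 := ⟨d', hdd'⟩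
    have h1 : d ∣ (14 * (l : ℤ)) ^ 4 := h0.trans ⟨343 * (l : ℤ) ^ 2, by ring⟩
    have h2 : d ∣ 14 * (l : ℤ) := (hsqf.dvd_pow_iff_dvd (by norm_num)).mp h1
    have hcop : IsCoprime d (l : ℤ) := ((hlp.irreducible.coprime_iff_not_dvd).mpr hld).symm
    exact hcop.dvd_of_dvd_mul_right h2
  have hle : d ≤ 14 := Int.le_of_dvd (by norm_num) h14
  interval_cases d <;> first | (exfalso; omega) | simp

/-- **`S'(−21ℓ, 112ℓ²) = S(42ℓ, −7ℓ²) ⊆ {1, −7}`** for a prime `ℓ ≡ 1 (mod 4)` with `(−7/ℓ) = −1`: the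
descent-on-divisors-of-`a² − 4b = −7ℓ²` Selmer set (Silverman X.4.9: `S^{(φ)}(E_{−ℓ}/ℚ)`).
`ℓ ∣ d`: reduced discriminant `42² + 28 = 1792 = 7·16²`, a non-residue mod `ℓ` since
`(7/ℓ) = (−1/ℓ)(−7/ℓ) = −1` — no `ℚ_ℓ`-point. So `d ∣ 7`; and `d = −1`, `d = 7` have no `ℚ_7`-point:
`7 ∤ −1` (resp. `7 ∤ −ℓ²`), `7 ∥ (42ℓ)² + 28ℓ² = 1792ℓ²`, so a `ℚ_7`-point would make `−1` (resp. `−ℓ²`)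
a square mod `7` (Zywina's lemma `isSquare_zmod_of_isSoluble_padic`).
[cite: SilvermanAEC2009, Prop. X.4.9] [cite: Zywina2025, Lemma 3.1 (proof)] -/
theorem mem_of_mem_twoIsogenySelmerGroup'_primeTwist {l : ℕ} [Fact l.Prime] (hl4 : l % 4 = 1)
    (hl7 : legendreSym l (-7) = -1) {d : ℤ}
    (hd : d ∈ twoIsogenySelmerGroup' (-21 * l) (112 * l ^ 2)) :
    d ∈ ({1, -7} : Finset ℤ) := by
  have hl : l.Prime := Fact.out
  haveI : Fact (Nat.Prime 7) := ⟨by norm_num⟩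
  have hlp : Prime (l : ℤ) := Nat.prime_iff_prime_int.mp hl
  have hl0 : (l : ℤ) ≠ 0 := by exact_mod_cast hl.ne_zero
  have hl2 : l ≠ 2 := by rintro rfl; norm_num at hl4
  have hl7' : l ≠ 7 := ne_seven_of_legendreSym hl7
  have hA : (-2 * (-21 * l : ℤ)) = 42 * l := by ring
  have hB : ((-21 * l : ℤ) ^ 2 - 4 * (112 * l ^ 2)) = -7 * l ^ 2 := by ring
  rw [twoIsogenySelmerGroup'_eq, hA, hB] at hd
  have hb : (-7 * l ^ 2 : ℤ) ≠ 0 := mul_ne_zero (by norm_num) (pow_ne_zero 2 hl0)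
  rw [mem_twoIsogenySelmerGroup_iff hb] at hd
  obtain ⟨hsqf, ⟨d', hdd'⟩, hloc⟩ := hd
  have hd'eq : (-7 * l ^ 2 : ℤ) / d = d' := by
    rw [hdd', Int.mul_ediv_cancel_left _ hsqf.ne_zero]
  rw [hd'eq] at hloc
  obtain ⟨-, hpadic⟩ := hloc
  -- the place `ℓ`: `ℓ ∤ d`
  have hld : ¬ (l : ℤ) ∣ d := by
    rintro ⟨e, rfl⟩
    have h1 : e * d' = -7 * l := mul_left_cancel₀ hl0 (by linear_combination (-1 : ℤ) * hdd')
    have h2 : (l : ℤ) ∣ e * d' := ⟨-7, by rw [h1]; ring⟩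
    rcases hlp.dvd_or_dvd h2 with h3 | h3
    · obtain ⟨e₁, rfl⟩ := h3
      exact hlp.not_unit (hsqf (l : ℤ) ⟨e₁, by ring⟩)
    · obtain ⟨e', rfl⟩ := h3
      have hm : e * e' = -7 := mul_left_cancel₀ hl0 (by linear_combination h1)
      have hns : ¬ IsSquare ((((42 : ℤ)) ^ 2 - 4 * (-7) : ℤ) : ZMod l) := by
        rw [show ((42 : ℤ) ^ 2 - 4 * (-7) : ℤ) = 1792 by norm_num]
        exact not_isSquare_seventeenNinetyTwo hl2 (legendreSym_seven_eq_neg_one hl4 hl7)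
      exact not_isSoluble_padic_of_prime_dvd_coeffs (p := l) (c := 42) (by ring) rfl rfl hm hns
        (hpadic l)
  -- so `d ∣ 7`, `d ∈ {±1, ±7}`
  have h7 : d ∣ 7 := by
    have h0 : d ∣ -7 * (l : ℤ) ^ 2 := ⟨d', hdd'⟩
    have h1 : d ∣ (7 * (l : ℤ)) ^ 2 := h0.trans ⟨-7, by ring⟩
    have h2 : d ∣ 7 * (l : ℤ) := (hsqf.dvd_pow_iff_dvd (by norm_num)).mp h1
    have hcop : IsCoprime d (l : ℤ) := ((hlp.irreducible.coprime_iff_not_dvd).mpr hld).symm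
    exact hcop.dvd_of_dvd_mul_right h2
  have hle : d ≤ 7 := Int.le_of_dvd (by norm_num) h7
  have hge : -7 ≤ d := by
    have := Int.le_of_dvd (by norm_num) ((Int.neg_dvd).mpr h7)
    linarith
  obtain ⟨k, hk⟩ := h7
  -- the two classes with no `ℚ_7`-point
  have hm1 : d ≠ -1 := by
    rintro rfl
    have hd'1 : d' = 7 * l ^ 2 := by linarith
    subst hd'1
    have hB1 : (7 : ℤ) ∣ (42 * (l : ℤ)) ^ 2 - 4 * (-1) * (7 * (l : ℤ) ^ 2) :=
      ⟨256 * (l : ℤ) ^ 2, by ring⟩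
    have hB2 : ¬ (7 : ℤ) ^ 2 ∣ (42 * (l : ℤ)) ^ 2 - 4 * (-1) * (7 * (l : ℤ) ^ 2) := by
      rw [show (42 * (l : ℤ)) ^ 2 - 4 * (-1) * (7 * (l : ℤ) ^ 2) = 1792 * (l : ℤ) ^ 2 by ring]
      exact not_sq_seven_dvd hl hl7'
    obtain ⟨-, hsq⟩ := isSquare_zmod_of_isSoluble_padic (p := 7) (by norm_num) (by decide) hB1 hB2
      (hpadic 7)
    exact not_isSquare_neg_one_zmod_seven hsq
  have hp7 : d ≠ 7 := by
    rintro rfl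
    have hd'1 : d' = -(l : ℤ) ^ 2 := by linarith
    subst hd'1
    have hsol := (isSoluble_map_twoIsogenyQuartic_comm (Int.castRingHom ℚ_[7]) (42 * (l : ℤ)) 7
      (-(l : ℤ) ^ 2)).mp (hpadic 7)
    have hnd : ¬ (7 : ℤ) ∣ -(l : ℤ) ^ 2 := by
      intro h
      have h7p : Prime (7 : ℤ) := Int.prime_iff_natAbs_prime.mpr (by norm_num)
      have h3 : (7 : ℤ) ∣ (l : ℤ) := h7p.dvd_of_dvd_pow ((Int.dvd_neg).mp h)
      have h4 : (7 : ℕ) ∣ l := by exact_mod_cast h3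
      exact hl7' ((Nat.prime_dvd_prime_iff_eq (by norm_num) hl).mp h4).symm
    have hB1 : (7 : ℤ) ∣ (42 * (l : ℤ)) ^ 2 - 4 * (-(l : ℤ) ^ 2) * 7 :=
      ⟨256 * (l : ℤ) ^ 2, by ring⟩
    have hB2 : ¬ (7 : ℤ) ^ 2 ∣ (42 * (l : ℤ)) ^ 2 - 4 * (-(l : ℤ) ^ 2) * 7 := by
      rw [show (42 * (l : ℤ)) ^ 2 - 4 * (-(l : ℤ) ^ 2) * 7 = 1792 * (l : ℤ) ^ 2 by ring]
      exact not_sq_seven_dvd hl hl7'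
    obtain ⟨hne, r, hr⟩ := isSquare_zmod_of_isSoluble_padic (p := 7) (by norm_num) hnd hB1 hB2 hsol
    apply not_isSquare_neg_one_zmod_seven
    have hl0' : ((l : ℤ) : ZMod 7) ≠ 0 := by
      intro h0
      apply hne
      push_cast at h0 ⊢
      rw [h0]; ring
    refine ⟨r * (((l : ℤ) : ZMod 7))⁻¹, ?_⟩
    push_cast at hr hl0' ⊢
    calc (-1 : ZMod 7) = -((l : ZMod 7) * (l : ZMod 7)⁻¹) ^ 2 := by rw [mul_inv_cancel₀ hl0']; ring
      _ = -(l : ZMod 7) ^ 2 * ((l : ZMod 7)⁻¹) ^ 2 := by ring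
      _ = r * r * ((l : ZMod 7)⁻¹) ^ 2 := by rw [← hr]
      _ = r * (l : ZMod 7)⁻¹ * (r * (l : ZMod 7)⁻¹) := by ring
  interval_cases d <;> first | (exfalso; omega) | simp

end Summit.BirchSwinnertonDyer.BirchSwinnertonDyer.Theorems.GoldfeldGoodTwists

end
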